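import Summits.AtomisticToContinuum.HydrodynamicLimit.Theorems.LambertianContactSwapContactAngleEquidistributionBoostFunctional
import Summits.AtomisticToContinuum.HydrodynamicLimit.Theorems.LambertianContactSwapContactAngleEquidistributionEqCruxUnconditional
import HarnessLib

/-!
# The crux for EVERY CONSTANT PROFILE (line `Sketch` v7, crux
# `LambertianContactSwap.ContactAngleEquidistribution`, stmt-AtomisticToContinuum-12097; lead c4)

Helper file (`--supports stmt-AtomisticToContinuum-12097`, registered stub `stub_eqConst`). The unconditional
equilibrium theorem `eq_contactAngleEquidistribution_unconditional` (lead c3, cycle 4) proves the body of the crux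
`ContactAngleEquidistribution` under the rest-frame unit-activity Gibbs law `localGibbsLaw σ 1 0 θ`. This file
extends it to ALL CONSTANT PROFILES `(a, u, θ)`, `a ≠ 0`, `θ > 0`, `u ∈ ℝ³` — the drifting global equilibria of
the torus gas, i.e. the crux VERBATIM on the class of constant profiles (`eq_contactAngleEquidistribution_const`) —
by two exact symmetries: the activity is decorative at fixed particle number
(`KineticWindowGronwallNegative.localGibbsLaw_const_activity`), and the drift is a Galilean boost: the drifting
law is the pushforward of the rest-frame law under the velocity translation `velShift u`
(`KineticWindowGronwallBoost.integral_localGibbsLaw_velShift`), while the crux functional is boost-covariant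
(`cruxFunctional_velShift`, cycle 5): `D_N[ψ](velShift u z) = D_N[ψ^u](z)` with the boosted test function
`ψ^u(s, x, v, w, n) = ψ(s, x + s u, v + u, w + u, n)`, which is again admissible (jointly measurable, `|ψ^u| ≤ 1`).
What the crux as filed still lacks is unchanged: non-constant profiles (`stub_cost`, T1', T2', item 12102 —
open-problem class, `Cruxes/ContactAngleEquidistribution/NOTES.md`).

References: C. Cercignani, R. Illner, M. Pulvirenti, *The Mathematical Theory of Dilute Gases* (1994), §4.2,
App. 4.A; D. Ruelle, *Statistical Mechanics: Rigorous Results* (1969), §4.2.3 (equilibrium inputs of cycle 3–4);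
Galilean invariance of hard-sphere dynamics: folklore (GST 2013 §1.1).
-/

noncomputable section

open MeasureTheory Filter Set Topology ProbabilityTheory Function
open scoped ENNReal BigOperators Classical RealInnerProductSpace

namespace Summit.AtomisticToContinuum.HydrodynamicLimit.Theorems.ContactAngleEquidistributionSketch

open Literature.Analysis Literature.Analysis.FluidPDE Literature.MathematicalPhysics.KineticTheory
open Summit.AtomisticToContinuum.HydrodynamicLimit.Theorems.KineticWindowGronwallBoost

/-- The boosted test function `ψ^u(s, x, v, w, n) = ψ(s, x + s u, v + u, w + u, n)` is jointly measurable when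
`ψ` is. [folklore] -/
theorem measurable_boostTest {ψ : ℕ → ℝ → T3 → V3 → V3 → V3 → ℝ}
    (hψm : ∀ N, Measurable (fun p : ℝ × T3 × V3 × V3 × V3 => ψ N p.1 p.2.1 p.2.2.1 p.2.2.2.1 p.2.2.2.2))
    (u : V3) (N : ℕ) :
    Measurable (fun p : ℝ × T3 × V3 × V3 × V3 =>
      ψ N p.1 (p.2.1 + FunctionSpaces.Torus.proj (p.1 • u)) (p.2.2.1 + u) (p.2.2.2.1 + u) p.2.2.2.2) := by
  have hg : Measurable (fun p : ℝ × T3 × V3 × V3 × V3 =>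
      (p.1, p.2.1 + FunctionSpaces.Torus.proj (p.1 • u), p.2.2.1 + u, p.2.2.2.1 + u, p.2.2.2.2)) :=
    measurable_fst.prodMk
      ((measurable_snd.fst.add
          (FunctionSpaces.Torus.continuous_proj.measurable.comp (measurable_fst.smul_const u))).prodMk
        ((measurable_snd.snd.fst.add_const u).prodMk
          ((measurable_snd.snd.snd.fst.add_const u).prodMk measurable_snd.snd.snd.snd)))
  exact (hψm N).comp hg

/-- **THE CRUX FOR EVERY CONSTANT PROFILE** (registered stub `stub_eqConst` of line `Sketch` v7): for all
`a ≠ 0`, `θ > 0`, `u ∈ ℝ³` there is `σ₀ > 0` (depending on `θ` only) such that for all `0 < σ < σ₀`, all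
families of hard-sphere flow structures `Φ`, all `t ≥ 0` and ALL admissible test functions `ψ_N (s, x, v, v_*, n)`
(jointly measurable, `|ψ_N| ≤ 1`; no modulus in `n` needed), the mean under the DRIFTING GLOBAL GIBBS LAW
`localGibbsLaw σ a u θ N (Φ N)` of the crux functional — the normalised `|g|²`-weighted collision sum of
`κ_g`-centred marks over Alexander's construction, VERBATIM the body of `ContactAngleEquidistribution` — tends to
`0` as `N → ∞`. Proof: activity dummy, Galilean pushforward of the law, boost covariance of the functional, and
the rest-frame theorem applied to the boosted test function `ψ^u`. [cite: CIP1994, App. 4.A pp. 107–111;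
Ruelle1969, §4.2.3 Thm 4.2.3] -/
theorem eq_contactAngleEquidistribution_const :
    let Cfg : ℕ → Type := fun N => Config (N + 1) (Fin 3) T3
    let G := Torus.geometry (Fin 3)
    let ε : ℝ → ℕ → ℝ := hsDiameter
    let τ : ℝ → (N : ℕ) → Cfg N → ℝ≥0∞ := fun σ N z => Alexander.freeExitTime G (ε σ N) z
    let S : ℝ → (N : ℕ) → Cfg N → Cfg N := fun t _ z => freeFlight G t z
    let ldir : V3 → V3 → V3 := fun ω ξ => ‖‖ω‖⁻¹ • ω + ‖ξ‖⁻¹ • ξ‖⁻¹ • (‖ω‖⁻¹ • ω + ‖ξ‖⁻¹ • ξ)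
    let zpre : ℝ → (N : ℕ) → Cfg N → ℕ → Cfg N := fun σ N z m =>
      let y := Alexander.stateAfter G (ε σ N) z m; S (τ σ N y).toReal N y
    let Kt : ℝ → (N : ℕ) → Cfg N → ℝ → ℕ := fun σ N z t => Alexander.collisionCount G (ε σ N) z t
    let hit : ℝ → (N : ℕ) → Cfg N → Fin (N + 1) → Fin (N + 1) → Prop := fun σ N y i j =>
      i < j ∧ y ∈ contactSet G (N + 1) (ε σ N) i j ∧ IsIncoming G y i j
    let tcol : ℝ → (N : ℕ) → Cfg N → ℕ → ℝ := fun σ N z m =>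
      (Alexander.collisionInstant G (ε σ N) z (m + 1)).toReal
    let xmid : (N : ℕ) → Cfg N → Fin (N + 1) → Fin (N + 1) → T3 := fun _ y i j =>
      G.translate (y j).1 ((2 : ℝ)⁻¹ • G.sepVec (y i).1 (y j).1)
    ∀ (a θ : ℝ) (u : V3), a ≠ 0 → 0 < θ → ∃ σ₀ : ℝ, 0 < σ₀ ∧ ∀ σ : ℝ, 0 < σ → σ < σ₀ →
      ∀ Φ : (N : ℕ) → HardSphereFlow G (ε σ N) (N + 1),
      let Q := fun N => localGibbsLaw σ (fun _ => a) (fun _ => u) (fun _ => θ) N (Φ N)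
      ∀ t : ℝ, 0 ≤ t → ∀ ψ : ℕ → ℝ → T3 → V3 → V3 → V3 → ℝ,
        (∀ N, Measurable (fun p : ℝ × T3 × V3 × V3 × V3 =>
          ψ N p.1 p.2.1 p.2.2.1 p.2.2.2.1 p.2.2.2.2)) →
        (∀ N s x v w n, |ψ N s x v w n| ≤ 1) →
        Tendsto (fun N : ℕ => ∫ z, ((N : ℝ) + 1) ^ (-(4 / 3 : ℝ)) *
          ∑ m ∈ Finset.range (Kt σ N z t), ∑ i : Fin (N + 1), ∑ j : Fin (N + 1),
            (let y := zpre σ N z m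
             if hit σ N y i j then
               ‖(y i).2 - (y j).2‖ ^ 2 *
                 (ψ N (tcol σ N z m) (xmid N y i j) (y i).2 (y j).2 ((ε σ N)⁻¹ • G.sepVec (y i).1 (y j).1) -
                   ∫ ξ, ψ N (tcol σ N z m) (xmid N y i j) (y i).2 (y j).2 (ldir (-((y i).2 - (y j).2)) ξ)
                     ∂(stdGaussian V3))
             else 0) ∂(Q N)) atTop (𝓝 0) := by
  have H := eq_contactAngleEquidistribution_unconditional
  have hcov := cruxFunctional_velShift
  dsimp only at H hcov ⊢
  intro a θ u ha hθ
  obtain ⟨σ₀, hσ₀, H⟩ := H θ hθ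
  refine ⟨σ₀, hσ₀, fun σ hσ hσlt Φ t ht ψ hψm hψb => ?_⟩
  have key := H σ hσ hσlt Φ t ht
    (fun N s x v w n => ψ N s (x + FunctionSpaces.Torus.proj (s • u)) (v + u) (w + u) n)
    (fun N => measurable_boostTest hψm u N) (fun N s x v w n => hψb N s _ _ _ n)
  refine (tendsto_congr fun N => ?_).mpr key
  have hu : (fun _ : T3 => u) = fun _ : T3 => (0 : V3) + u := by
    funext
    rw [zero_add]
  rw [KineticWindowGronwallNegative.localGibbsLaw_const_activity ha σ θ u N (Φ N), hu,
    integral_localGibbsLaw_velShift σ 1 hθ 0 u N (Φ N) (Φ N)]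
  exact congrArg (fun f : Config (N + 1) (Fin 3) T3 → ℝ => ∫ z, f z ∂(localGibbsLaw σ (fun _ => 1)
    (fun _ => (0 : V3)) (fun _ => θ) N (Φ N))) (funext fun z => hcov ψ u σ N t z)

end Summit.AtomisticToContinuum.HydrodynamicLimit.Theorems.ContactAngleEquidistributionSketch

end
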